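import Mathlib
import HarnessLib
import HarnessLib.Audit
import Summits.Parity.Statement
import Literature.NumberTheory.Sieve.MoebiusShiftedPrimes

/-!
Route: MinorArcDecorrelation

CLOSED (retired) 2026-08-15T13:50:08Z by operator:999:1257524 — reason: not-a-thesis: assembly does not conclude the sub-problem Statement — note: D-0027 §2.1 audit (human 2026-08-15: routes that do not decide the summit are removed): the assembly concludes `MobiusDilatedShiftedPrimes`, not the sub-problem statement; a NEW conforming route may be opened from the same idea (generated `closes : … → _root_.GeneralizedHardyLittlewood`).. The file is kept as the record of this route; refuted decls are indexed as negative knowledge (`ledger negatives`).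

# Route MinorArcDecorrelation — Liouville delta-method — coset/fan decorrelation (MAD) gives
power-saving Type II for λ(mn+c), hence μ ⟂ dilated shifted primes

It suffices to show X = MAD := CosetDecorrelation ∧ FanDecorrelation (card minor-arc-decorrelation,
re-derived in the efficient frame).
Write F(m,m′) = λ(mn+c)λ(m′n′+c) for a shift c ≠ 0 and dilations n ≠ n′ ≤ 2M, m, m′ ∈ (M,2M], Q =
⌊√M⌋+1, J = [Q,2Q).
CosetDecorrelation (MAD proper): the coset sums T_j = ∑_{m ≡ m′ (mod j)} F(m,m′), j ∈ J —
equivalently (1/j)∑_{a mod j} G_n(a/j)·conj G_{n′}(a/j)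
with G_n(α) = ∑_m λ(mn+c)e(αm), i.e. decorrelation of the Liouville exponential sums along two
progressions across the Farey points of ONE
denominator j ≍ √M — satisfy |T_j| ≤ C·M^{3/4+ϑ} for some ϑ < 1/4 (random size M^{3/4}; trivial
M^{3/2}). FanDecorrelation (the
complementary-divisor companion of the δ-method): the fan sums R_k = ∑_{j∈J} ∑_{m−m′=kj} F(m,m′), k
≠ 0, obey the same bound. Both uniformly in
1 ≤ n ≠ n′ ≤ 2M (balanced range). Conditional bridge in spirit: MAD is a λ-only, numerically
testable hypothesis of beyond-GRH strength;
everything downstream of it is provable now.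
Lean: `(∀ c : ℤ, c ≠ 0 → ∃ ϑ : ℝ, ϑ < 1 / 4 ∧ ∃ C : ℝ, ∀ M n n' j : ℕ, 1 ≤ n → 1 ≤ n' → n ≠ n' → n ≤
2 * M → n' ≤ 2 * M → Nat.sqrt M + 1 ≤ j → j < 2 * (Nat.sqrt M + 1) → |∑ p ∈ (Finset.Ioc M (2 * M) ×ˢ
Finset.Ioc M (2 * M)).filter (fun p : ℕ × ℕ => p.1 ≡ p.2 [MOD j]), (ArithmeticFunction.liouville
(Int.toNat ((p.1 : ℤ) * n + c)) : ℝ) * (ArithmeticFunction.liouville (Int.toNat ((p.2 : ℤ) * n' +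
c)) : ℝ)| ≤ C * (M : ℝ) ^ (3 / 4 + ϑ)) ∧ (∀ c : ℤ, c ≠ 0 → ∃ ϑ : ℝ, ϑ < 1 / 4 ∧ ∃ C : ℝ, ∀ M n n' :
ℕ, ∀ k : ℤ, 1 ≤ n → 1 ≤ n' → n ≠ n' → n ≤ 2 * M → n' ≤ 2 * M → k ≠ 0 → |∑ j ∈ Finset.Ico (Nat.sqrt M
+ 1) (2 * (Nat.sqrt M + 1)), ∑ p ∈ (Finset.Ioc M (2 * M) ×ˢ Finset.Ioc M (2 * M)).filter (fun p : ℕ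
× ℕ => (p.1 : ℤ) - p.2 = k * (j : ℤ)), (ArithmeticFunction.liouville (Int.toNat ((p.1 : ℤ) * n + c))
: ℝ) * (ArithmeticFunction.liouville (Int.toNat ((p.2 : ℤ) * n' + c)) : ℝ)| ≤ C * (M : ℝ) ^ (3 / 4 +
ϑ))`

## Assembly
Pure composition, machine-checked in the planner's Sketch.lean (`example (g1 :
DecorrelationToDilatedChowla) (g2 : DilatedChowlaToTypeII)
(g3 : VaughanReduction) (g4 : LiouvilleToMobius) : Assembly := fun hC hF hBV => (g4 (g3 (g2 (g1 hC
hF)) hBV)).1`, rc 0): the two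
decorrelations give DilatedChowla by DivisorSwitch, Cauchy–Schwarz gives TypeIILiouville,
Vaughan/Heath-Brown with BV for λ gives Λλ-cancellation
in every fixed progression, LiouvilleToMobius gives 0612 (and MoebiusShiftedPrimesConjecture).
Beyond this route (not items): the m ≤ x^ε-uniform
version feeds M_avg = stmt-Parity-0613; route MobiusShiftedPrimes' Assembly (stmt-Parity-0611,
provable) gives EH ∧ M_avg(h) ⇒ Hardy–Littlewood
pairs; tuples and DicksonFibration (DimOne → GHL) carry it to
Summit.Parity.GeneralizedHardyLittlewood. So MAD ⇒ the parity half unconditionally in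
everything else; MAD ∧ EH(+tuple analogues) ⇒ the GHL conjunct.

Rationale: WHY THIS LINE. Pitt's cusp-form analogue of the Titchmarsh divisor problem (Pitt2012) shows the
architecture closes: decompose the prime, keep the
automorphic coefficient whole, and win the Type-II step ∑_{m}|∑_n β_n a(mn+h)|² through shifted
convolution sums treated by the
Duke–Friedlander–Iwaniec δ-symbol (DukeFriedlanderIwaniec1994: divisor switching δ(d) = ∑_{q∣d}(w(q)
− w(|d|/q)), moduli ≤ 2√U) plus
Voronoi + Kuznetsov; for Liouville λ everything survives except Voronoi, and the card isolates the
ONE additive statement the δ-method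
consumes (minor-arc decorrelation at a fixed denominator) — Polymath8b2014 §8 p.36 and Harman2007
§14.2 p.286 name exactly this Type-II
information as the missing, parity-breaking input ("we do not have any Type II information at all").
Re-deriving the bookkeeping in the
(m,m′) frame (detect m = m′ for S(n,n′;M) = ∑_{m∼M} λ(mn+c)λ(mn′+c), level Q = √M, instead of n′k −
nk′ = c at level √(nn′M)) makes the
δ-method an exact ELEMENTARY identity |J|·S = ∑_{j∈J} T_j − ∑_{k≠0} R_k (item DivisorSwitch; rows =
cosets, columns = fans of the array of
line sums), removes the card's range restriction nn′ ≤ M^{1−2θ} (an artifact of the inefficient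
detector), and shows Q = √M is optimal
with room M^{1/4} on both sides — so ϑ < 1/4 on cosets and fans gives S ≪ M^{3/4+ϑ}, i.e.
power-saving two-point Chowla for every dilated
pair, uniformly in the dilations; Cauchy–Schwarz then gives Type II for λ(mn+c) on the WHOLE
balanced range [x^δ, x^{1/2}] with a power
saving, so Vaughan/Heath-Brown (Vaughan1980, Heathbrown1982) with Bombieri–Vinogradov for λ as the
only Type-I input yields
∑_{n≤x, n≡w (m)} Λ(n)λ(n+c) ≪ x(log x)^{-A}, and the in-ledger glue LiouvilleToMobius
(stmt-Parity-4223) lands on the shared atom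
stmt-Parity-0612 of routes MobiusShiftedPrimes / ShiftedMultiplicationTable and on
MoebiusShiftedPrimesConjecture. Imported areas: GL(2)
shifted-convolution technology as architecture (DFI, Pitt, HeathBrown1996Crelle481), the
random-matrix/probabilistic square-root law as
the calibration of the hypothesis (MatomakiRadziwillTao2015 for what is proved on average: o(),
never a power), and the card's spectral
dictionary (explicit formula for λχ as the 'Voronoi' step: T_j is a bilinear form in zero-sums of
distinct L(s,χ), χ mod jn, jn′).
Relative to the existing routes: ShiftedMultiplicationTable files the CRITERION (RectangleChowla,
log-power fourth moment on [x^δ,x^{1/3+δ}],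
plus a Type-I₂ crux forced by the 1/3 wall) with no engine; this route files an ENGINE one level
upstream with a provable reduction, needs
no Type-I₂ and no window bookkeeping (Type II covers [x^δ, x^{1/2}]), and pays for it with a
hypothesis of beyond-GRH strength, said openly.

RANKED CRUXES. #0 MAD (target) — X = CosetDecorrelation ∧ FanDecorrelation (the two decorrelation
hypotheses of § Thesis; card minor-arc-decorrelation item 3 in the (m,m′) frame, card θ = 2ϑ). (why
it might fail: both halves are square-root laws for deterministic λ with only (log M)^{1/2} of room
in the random model; each is false in the Landau–Siegel caricature λ ≈ χ₁ (mod q), q ≤ M^{1/4−ϑ}, q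
∣ j.) [Pitt2012, DukeFriedlanderIwaniec1994, Polymath8b2014, Harman2007]
#2 CosetDecorrelation (crux) — MAD proper (card item 3, efficient frame). For every shift c ≠ 0
there are ϑ < 1/4 and C such that for all M, all dilations 1 ≤ n ≠ n′ ≤ 2M and all moduli j ∈ [Q,
2Q), Q = ⌊√M⌋+1: |∑_{m,m′∈(M,2M], m≡m′ (mod j)} λ(mn+c)λ(m′n′+c)| ≤ C·M^{3/4+ϑ}. Equivalently ∑_{a
mod j} G_n(a/j) conj G_{n′}(a/j) ≪ j·M^{3/4+ϑ} with G_n(α) = ∑_{m∼M} λ(mn+c)e(αm): the Liouville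
exponential sums along the progressions c mod n and c mod n′ decorrelate across the Farey points of
one denominator j ≍ √M (random size M^{3/4}, trivial M^{3/2}; c = 0 or n = n′ would make T_j a
variance ≈ +M^{3/2}/j, hence the exclusions). [difficulty: open-problem] (why it might fail: Random
model leaves only √(log M) below M^{3/4}, so ϑ>0 is load-bearing; a Landau–Siegel character χ₁ mod
q∣j, q ≤ M^{1/4−ϑ}, in its mimicry range forces T_j ≈ M^{3/2}/(jq); no deterministic multiplicative
function is known to satisfy any bilinear decorrelation of this strength (beyond GRH).) [Pitt2012,
DukeFriedlanderIwaniec1994, Polymath8b2014, TaoTeravainen2021, Montgomery1971,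
Literature.Barriers.Parity.UnboundedSiegelZeros]
#3 FanDecorrelation (crux) — The complementary-divisor half of the δ-method (card item 1's 'trivial
ranges / u-integral', made explicit). Same quantifiers; for every k ≠ 0: |∑_{j∈[Q,2Q)}
∑_{m,m′∈(M,2M], m−m′=kj} λ(mn+c)λ(m′n′+c)| ≤ C·M^{3/4+ϑ}. Dually R_k = ∑_{j∈J} A(kj) is an average,
over ≍ √M second-shifts in arithmetic progression (difference k·n′), of the dilated two-point sums
A(d) = ∑_m λ(mn+c)λ(mn′+c−dn′); for k = 1 it is ∑_m λ(mn+c) × (λ summed over √M consecutive terms of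
the progression c mod n′). Square-root cancellation in the signed average is asked (random size
M^{3/4}; empty for |k| > M/Q). [difficulty: open-problem] (why it might fail: Decoupling λ(mn+c)
from the short progression sums by Cauchy–Schwarz caps any proof at M^{5/4} (even under GRH), so
genuinely bilinear cancellation is needed; Matomäki–Radziwiłł–Tao averaging gives o(M^{3/2}), never
M^{3/4+ϑ}; same Siegel caricature as for cosets.) [MatomakiRadziwillTao2015,
MatomakiRadziwillAnnals2016, DukeFriedlanderIwaniec1994, TaoFMP2016]
#4 DilatedChowla (crux) — The node the route's engine delivers and the sieve consumes: power-saving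
two-point Chowla for DILATED pairs, uniform in the dilations. For every c ≠ 0 there are κ > 0 and C
with |∑_{m∈(M,2M]} λ(mn+c)λ(mn′+c)| ≤ C·M^{1−κ} for all M and all 1 ≤ n ≠ n′ ≤ 2M. (Implied by
cruxes 2 ∧ 3 with κ = 1/4 − ϑ via DivisorSwitch; filed as a crux so that other engines and refuters
can engage the OUTPUT directly; n = 1 is ∑_k λ(k)λ(n′k + c(1−n′)).) [deps: CosetDecorrelation,
FanDecorrelation] [difficulty: open-problem] (why it might fail: Power savings in λ-correlations are
GRH-deep: heuristically a zero β > 1−κ/2 of ζ or of L(s,χ), χ mod nn′, leaves a term M^{2β−1} (cf.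
Bhowmik–Ruzsa for Goldbach averages); only the log-averaged o() is known (Tao FMP 2016 Thm 1.2);
uniformity n,n′ ≤ 2M is level 1/2.) [TaoFMP2016, BhowmikRuzsa2018, HelfgottRadziwill2021,
Literature.Barriers.Parity.GoldbachAverageZeros,
Literature.Barriers.Parity.Polymath2014_liouvillePairAP]
#9 DivisorSwitch (support) — The δ-method as an exact elementary identity (DFI divisor switching
with sharp weights, no Fourier analysis): for every f : ℕ → ℕ → ℝ and all M, Q, |J|·∑_{m∈(M,2M]}
f(m,m) + ∑_{0<|k|≤M} ∑_{j∈J} ∑_{m−m′=kj} f(m,m′) = ∑_{j∈J} ∑_{m≡m′ (mod j)} f(m,m′), J = [Q,2Q),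
pairs in (M,2M]². Proof: for each j split the coset by k = (m−m′)/j; k = 0 is the diagonal. (Checked
numerically by the planner for M ≤ 20, all Q.) [difficulty: provable-now]
[DukeFriedlanderIwaniec1994, HeathBrown1996Crelle481, IwaniecKowalski2004]
#9 DecorrelationToDilatedChowla (support) — CosetDecorrelation → FanDecorrelation → DilatedChowla.
Proof: DivisorSwitch with f(m,m′) = λ(mn+c)λ(m′n′+c), Q = ⌊√M⌋+1 (so |J| = Q, Q² > M); the fan sums
are EMPTY for |k| > M/Q, so |S| ≤ (1/Q)(Q·C₁M^{3/4+ϑ₁} + 2(M/Q)·C₂M^{3/4+ϑ₂}) ≤ (C₁+2C₂)M^{1−κ}, κ =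
1/4 − max(ϑ₁,ϑ₂) > 0. [difficulty: provable-now] [DukeFriedlanderIwaniec1994, Pitt2012]
#9 TypeIILiouville (support) — Power-saving Type II for λ(mn+c) on the balanced range (short
variable n ≤ long variable m, dyadic boxes, arbitrary real coefficients): for c ≠ 0 there are η > 0,
C with |∑_{m∈(M,2M]}∑_{n∈(N,2N]} α_m β_n λ(mn+c)| ≤ C‖α‖₂‖β‖₂ (MN)^{1/2}(N^{−1/2} + M^{−η}) whenever
1 ≤ N ≤ M. The bilinear, main-term-free, parity-sensitive input Polymath 8b §8 and Harman §14.2 ask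
for; sub-boxes by zero-extension of the coefficients. [difficulty: open-problem] [Polymath8b2014,
Harman2007, BourgainSarnakZiegler2013, FordMaynard2024PrimeSieves]
#9 DilatedChowlaToTypeII (support) — DilatedChowla → TypeIILiouville by Cauchy–Schwarz over the long
variable: |B|² ≤ ‖α‖² ∑_{n,n′} β_nβ_{n′} ∑_m λ(mn+c)λ(mn′+c) ≤ ‖α‖²‖β‖²(M + N·C M^{1−κ}) (diagonal n
= n′ has M terms; (∑|β_n|)² ≤ N‖β‖²; n′ ≤ 2N ≤ 2M is inside DilatedChowla's range), so η = κ/2.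
[difficulty: provable-now] [Harman2007, IwaniecKowalski2004]
#9 BombieriVinogradovLiouville (support) — Bombieri–Vinogradov for λ at level x^{1/2−ε} with
absolute values, one arbitrary residue c_d ∈ [0,d) and height y_d ≤ x per modulus d ≥ 1:
∑_{d≤x^{1/2−ε}} |∑_{n≤y_d/d} λ(dn+c_d)| ≤ Cx/(log x)^A. Known theorem (Heath-Brown identity for λ =
μ∗1_□ + BFI Theorem 0(b) + Siegel–Walfisz for λ, all in tree). NB: this is stmt-Parity-4220 of route
ShiftedMultiplicationTable with the residue condition restricted to d ≥ 1 — as filed there (∀ d, 0 ≤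
c d ∧ c d < d) the d = 0 instance is unsatisfiable and 4220 is vacuously true (planner's
kernel-checked note, folder VacuityTest.lean), hence unusable as a hypothesis. [difficulty: L]
[BombieriFriedlanderIwaniecActa1986, IwaniecKowalski2004, Vaughan1980, Heathbrown1982]
#9 VaughanReduction (support) — TypeIILiouville → BombieriVinogradovLiouville → for every modulus m
≥ 1, class w, shift c ≠ 0 and A: |∑_{n≤x, n≡w (m)} Λ(n)λ(n+c)| ≤ Cx/(log x)^A (verbatim the
antecedent of LiouvilleToMobius). Plan: Heath-Brown's identity (in tree, K = 2) or Vaughan's with U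
= V = x^{1/10}; any factorisation with a partial product in [x^{1/10}, x^{9/10}] is Type II (short
side ≤ x^{1/2} ≤ long side; divisor-bounded coefficients cost log powers against the power saving
N^{−1/2}+M^{−η}; the class n ≡ w (m) by splitting coefficients into classes; the cut mn ≤ x by
x^{−η/3}-fine subdivision); otherwise one smooth variable ≥ x^{9/10} ⇒ Type I with modulus ≤
x^{1/10} ⇒ BombieriVinogradovLiouville (log weight by partial summation using the free heights y_d;
τ-bounded outer coefficients by Cauchy–Schwarz against the trivial bound). Output only log-power
because Type I is. [difficulty: L] [Vaughan1980, Heathbrown1982, Harman2007, IwaniecKowalski2004]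
#9 LiouvilleToMobius (support) — (= stmt-Parity-4223 of route ShiftedMultiplicationTable, verbatim,
shared by signature.) Λ(n)λ(n+c) small in every fixed progression for all c ≠ 0 ⇒ ∑_{d≤x}
μ(d)Λ(dm+h) = o(x) for all m,h ≥ 1 (stmt-Parity-0612) and MoebiusShiftedPrimesConjecture; squarefree
sieve μ(n) = λ(n)∑_{k²∣n}μ(k), complete multiplicativity, Brun–Titchmarsh tail. [difficulty: M]
[Lichtman2020, Ramare2018ChowlaLiouvilleMoebius,
Literature.NumberTheory.Sieve.MoebiusShiftedPrimesConjecture]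
#9 MobiusDilatedShiftedPrimes (support) — (= stmt-Parity-0612, crux r2 of route MobiusShiftedPrimes
and terminal node of ShiftedMultiplicationTable, verbatim.) For all m, h ≥ 1: ∑_{d≤x} μ(d)Λ(dm+h) =
o(x). This route does not attack it directly; its Assembly delivers it, so a refutation of 0612
breaks this route too. [difficulty: open-problem]
[Literature.NumberTheory.Sieve.MoebiusShiftedPrimesConjecture, Lichtman2020, Harman2007]

TWO-LAYER PLAN. Foreseen glued splits (k ≤ 3, depth 1), filed only when a crux closes or stalls with
a census: CosetDecorrelation ⇐ CosetMajorLines (the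
'ratio major arcs': pairs on lines r(m′n′+c) = p(mn+c) with pr ≤ P carry the constant sign λ(pr);
their total is controlled by PNT-type
input for λ on intervals) → CosetMinorLines (genuine 2-D cancellation off those lines) →
CosetDecorrelation; CosetDecorrelation ⇐ CosetGRHRange
(dilations n,n′ ≤ √M only — index ≤ (box)^{1/2}, the regime where GRH-type family statistics could
speak; by the same chain it gives lopsided
Type II on [x^δ, x^{1/3}] and, with Harman's comparison sieve, both signs of λ(p+2) with density ≥
(1−log 2)/2, the card's Pintz payoff) →
CosetMontgomeryRange (√M < n,n′ ≤ 2M) → CosetDecorrelation, and the same for FanDecorrelation;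
VaughanReduction ⇐ HeathBrownCasework →
TypeITreatment → VaughanReduction.

KILL CRITERIA. CosetDecorrelation or FanDecorrelation REFUTED for some c — a sequence (M, n, n′, j
or k) with |T_j| or |R_k| ≥ M^{1−o(1)} — closes the route
(`close --reason refuted:CosetDecorrelation` resp. FanDecorrelation) unless the witness lives in an
explicit thin family (q ∣ j for an
exceptional modulus q, or j tied to n′ − n), in which case restate with that family excepted (pivot,
one restate only). DilatedChowla refuted
(|S(n,n′;M)| ≥ M^{1−o(1)} along a sequence) closes the route outright — both decorrelations die with
it by DivisorSwitch. A THEOREM of the form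
'DilatedChowla (or MAD) ⇒ quasi-Riemann hypothesis for ζ or for L(s,χ) mod nn′' does not refute but
re-grades the route CONDITIONAL(GRH+): record
it as a barrier extension of GoldbachAverageZeros and keep only the unconditional items staffed.
DivisorSwitch, DecorrelationToDilatedChowla,
DilatedChowlaToTypeII are identities/bookkeeping: a refutation means a typo — restate, never close.
VaughanReduction refuted (e.g. the diagonal
term N^{−1/2} of TypeIILiouville is too weak at N = x^δ for the chosen U, V) ⇒ restate
TypeIILiouville with the needed range (pivot).
stmt-Parity-0612 proved elsewhere ⇒ close superseded; 0612 refuted ⇒ this route, MobiusShiftedPrimes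
and ShiftedMultiplicationTable break together.

NOT DECOMPOSED YET. The spectral form of CosetDecorrelation (characters mod jn, jn′ and the explicit
formula for ∑λχ as the 'Voronoi' step: T_j as a bilinear
form in zero-sums of distinct Dirichlet L-functions — card item 4's GRH-conditional log-power
foothold via 2-level densities); smooth weights
and the u-twisted version of the card (not needed in the (m,m′) frame); the lopsided/Harman sign
theorem for λ(p+2) (layer-2 child of the
GRH-range split above); the m ≤ x^ε-uniform upgrade 0612 → 0613 (M_avg) and k-point versions;
uniformity in the shift c; effective constants
(BV for λ is Siegel-ineffective); kit numerics at scale (M = 10⁵–10⁶, n ∼ M) — requested below as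
the cheapest falsifier, not run on the
compute-free hub beyond the planner's M ≤ 2500 sanity table.

CHEAPEST FALSIFIER. (i) Numerics (kit): max_j |T_j|/M^{3/4} and max_k |R_k|/M^{3/4} for c ∈ {±1, 2},
(n,n′) ∈ {(1,2),(2,3),(3,7),(1,5)} and n ∼ M/2, n ∼ M,
M = 10⁴…10⁶ (segmented λ-sieve to 4M²): growth like M^{η}, η near 1/4, kills the usable range of ϑ.
Planner's pure-Python run (folder
num/mad_frame*.py, M = 600 and 2000, 18 (c,n,n′) each incl. n ∼ M/2 and n ∼ M): max|T_j|/M^{3/4} ∈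
[1.3, 3.3], rms 0.6–1.0,
max|R_k|/M^{3/4} ∈ [1.2, 3.4], rms 0.5–0.8, |S|/√M ≤ 1.9, identity exact in every case — square-root
law with constant ≈ 1, no drift
between the two scales. (ii) One page of logic: does DilatedChowla ∧ BV ⇒ a zero-free half-plane
(Bhowmik–Ruzsa's kernel argument adapted to ∑Λ(n)λ(n+c), or the explicit formula for ∑_m
λ(mn+c)λ(mn′+c) via L(s,χ) mod nn′)? A yes re-grades
the route GRH+-conditional (expected) but does not close it. (iii) Siegel caricature: with λ
replaced by a real primitive χ₁ mod q, q ∣ j,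
T_j = (M/j)²∑_{b mod j}χ₁((bn+c)(bn′+c)) ≈ M²/(jq) ≫ M^{3/4+ϑ} for q ≤ M^{1/4−ϑ}: the cruxes exclude
exceptional zeros there; a refuter may
upgrade this to '¬CosetDecorrelation under Literature.Barriers.Parity.UnboundedSiegelZeros' (route
then explicitly GRH-world; acceptable).

NUMBERS. Sizes in the (m,m′) frame, Q = ⌊√M⌋+1: T_j has ≈ M²/j ∈ [M^{3/2}/2, M^{3/2}] terms, R_k ≈
Q(M − |k|Q·3/2) ≤ M^{3/2}; random size M^{3/4} for
both; needed ≤ M^{1−ε}; room M^{1/4} on each side and Q = M^q gives rooms M^{q/2}, M^{3q/2−1/2},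
equal only at q = 1/2 (so √M is optimal and no
choice of Q makes a log-power hypothesis suffice: q → 1 degenerates to per-line Chowla, q → 1/3
needs full square-root in R). Card
dictionary: card's MAD_θ at q ≍ √(nn′M) ↔ ϑ = θ/2 here; the card's window N ≤ x^{(1−2θ)/(3−2θ)}
disappears (detector inefficiency), replaced
by the uniformity range of the dilations: n,n′ ≤ M^ρ gives Type II for N ≤ x^{ρ/(1+ρ)} (ρ = 1/2:
x^{1/3}, the card; ρ = 1: x^{1/2}, filed).
Type II saving: N^{−1/2} + M^{−κ/2}; with Vaughan U = V = x^{1/10} every Type-II box has x^{1/10} ≤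
N ≤ x^{1/2} ≤ M, saving ≥ x^{−1/20} +
x^{−κ/4}, against coefficient norms ‖α‖₂‖β‖₂ ≤ (MN)^{1/2}(log x)^{B}. Type-I level needed:
x^{1/10}·m (BV gives x^{1/2−ε}). Known inputs:
log-averaged dilated two-point Chowla ∑ λ(a₁n+b₁)λ(a₂n+b₂)/n = o(log ω(x)) (TaoFMP2016 Thm 1.2, a₁b₂
≠ a₂b₁); averaged Chowla o(HX) for H → ∞
(MatomakiRadziwillTao2015); Harman2007 p.286: no Type II for p+2 at all. Planner numerics (M = 600;
c, n, n′, S/√M, max|T|/M^{3/4},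
rms|T|/M^{3/4}, max|R|/M^{3/4}): (1,1,2: 0.00, 1.35, 0.64, 2.20), (1,301,303: −0.08, 1.45, 0.70,
1.49), (1,601,1199: 0.00, 1.39, 0.71, 1.43),
(−1,1,5: −0.98, 2.47, 0.77, 1.60), (2,601,1199: 0.24, 2.56, 0.78, 2.71); M = 2000 (Q = 45, 18 rows,
folder num/out_2000.txt): max|T|/M^{3/4}
∈ [1.51, 3.24] (rms 0.69–0.98), max|R|/M^{3/4} ∈ [1.47, 3.16] (rms 0.48–0.76), |S|/√M ≤ 1.92, e.g.
(1,1001,1003: 0.89, 1.58, 0.76, 2.04),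
(2,2001,3999: −0.76, 2.20, 0.85, 3.16). Items at open: 13 (3 cruxes, 1 target, 8 support, 1
assembly). Ledger note: stmt-Parity-4220 (BVLiouville of route ShiftedMultiplicationTable) is
vacuously
true as filed (its residue hypothesis at d = 0 reads 0 ≤ c 0 < 0; kernel-checked in folder
VacuityTest.lean) — this route files the corrected
statement BombieriVinogradovLiouville (d ≥ 1) instead of sharing 4220.

DEFINITION REQUESTS. None for Lean notions (ArithmeticFunction.liouville / moebius / vonMangoldt,
Nat.sqrt, Nat.ModEq are Mathlib). Bib: DukeFriedlanderIwaniec1994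
added this session (ledger bib add, commit 254dd716b5ad). No cite facts wanted: every
non-conjectural input (BV for λ, Heath-Brown identity,
Siegel–Walfisz for λ, BFI Theorem 0(b)) is in tree or filed as support.

Novelty: Searches (2026-08-15): local searchd `lit search` timed out (rc 75) and OpenAlex/arXiv were
rate-limited (429) — recorded; ran `lit search
--source crossref "Liouville function bilinear sums shifted products type II parity"` (12 rows, none
relevant: Kowalski–Michel–Sawin bilinear
Kloosterman, Shparlinski Gauss sums), `lit search --source zbmath "Liouville function shifted
convolution"` (2: Krishnamoorthy arXiv:2501.10962
on variants of Chowla), `… zbmath "averaged Chowla conjecture correlations Liouville"` (3: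
TaoTeravainenDuke2019, TaoFMP2016, Frantzikinakis
arXiv:1606.08420), `lit galaxy search --star all` on "correlations of the Liouville function along
dilated", "bilinear forms with the Liouville
function", "Titchmarsh divisor problem for the Liouville function" (0/0/0 hits each), `lit galaxy
search --star pdf --mode bm25` on Type-II sums
of λ(mn+h)/δ-method for λ (12 rows: Harcos arXiv:math/0101096 additive problem for cusp-form
coefficients = the automorphic analogue;
Tao–Teräväinen Gowers-uniformity of μ; nothing on λ), `lit frontier Parity --since 2021` (30 rows,
none on bilinear λ(mn+h)), `lit read
arxiv:1509.05422` (Thm 1.2 confirmed for dilated pairs), `lit read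
book:harman2007-prime-detecting-sieves` p.286, `ledger negatives --problem
Parity` (0), lean search for every constant (ArithmeticFunction.liouville, Nat.sqrt,
MoebiusShiftedPrimesConjecture, heathBrown_identity).
Nearest prior art found: Pitt2012 (doi:10.1090/s0894-0347-2012-00750-4: the GL(2) theorem whos  [refs: 10.1090/s0894-0347-2012-00750-4:, 2501.10962, 1606.08420, math/0101096, 1509.05422, arxiv:1509.05422, book:harman2007-prime-detecting-sieves, doi:10.1090/s0894-0347-2012-00750-4, TaoTeravainenDuke2019, TaoFMP2016, Pitt2012, DukeFriedlanderIwaniec1994, MatomakiRadziwillTao2015, Harman2007]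

Barriers (technique_class: delta-method type-II liouville bilinear-decorrelation): - technique_class: delta-method type-II liouville bilinear-decorrelation
- Literature.Barriers.Parity.CircleMethodBinaryBarrier: the barrier kills minor-arc treatments by
SIZE (|S|, L², large sieve); the route's circle method is the divisor-switch identity and its
hypothesis MAD is a PHASE statement — signed cancellation in ∑_{a mod j} G_n(a/j)conj G_{n′}(a/j)
and in signed fan averages — exactly the 'cancellation in the arguments on the minor arcs' the
barrier's sources leave open; conceded: it is a hypothesis, not a theorem.
- Literature.Barriers.Parity.SelbergParityBarrier: Type-I information of any level leaves
∑Λ(n)λ(n+c) undetermined (Bombieri indeterminacy); the decisive input here is bilinear and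
parity-SENSITIVE (TypeIILiouville fails for Selberg's ghosts 1 ± λ and for small-conductor
pretenders), so the route is outside the barrier's type-I class.
- Literature.Barriers.Parity.PrimePairParity: the weight-insertion test fails for the route's input
— ω = 1 − λ(n)λ(n+2) is not a function of the product mn + c, so Type II for λ(mn+c) is not
weight-insertion invariant; it is the 'bilinear expressions' exit Polymath §8 name, supplied
conditionally on MAD.
- Literature.Barriers.Parity.FordMaynardMinimalTypeII: respected, not evaded — some Type-II window
is necessary at Type-I level 1/2, and the route supplies the whole balanced window [x^δ, x^{1/2}]
(TypeIILiouville) with a power saving.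
- Literature.Barriers.Parity.FordMaynardLowLevel: not applicable — with (γ, θ, ν) = (1/

History (route lifecycle, newest last):
- 2026-08-15T12:33:20Z · rev 1: restated MAD (stmt-Parity-8049) — target MAD restated self-contained: the gate renders the rank-0 target above the crux decls, so the local references CosetDecorrelation/FanDecorrelation were bl (planner-plancard-Parity-GeneralizedHardyLittl-6d31bf21-0)
- 2026-08-15T13:50:08Z · CLOSED retired — not-a-thesis: assembly does not conclude the sub-problem Statement (operator:999:1257524)

sub-problem: GeneralizedHardyLittlewood · status: closed(retired) · opened planner-plancard-Parity-GeneralizedHardyLittl-6d31bf21-0 2026-08-15T12:26:34Z · rev 1 · ledger route-Parity-MinorArcDecorrelation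
GENERATED by the gate from the ledger (D-0016/17). Provers cite these decls: `theorem foo : Summit.Parity.GeneralizedHardyLittlewood.Theses.MinorArcDecorrelation.<Decl> := …` in Summits/Parity/GeneralizedHardyLittlewood/Theorems/<Name>.lean.
-/

namespace Summit.Parity.GeneralizedHardyLittlewood.Theses.MinorArcDecorrelation

open scoped BigOperators Topology Manifold Classical MeasureTheory ProbabilityTheory Matrix InnerProductSpace ComplexConjugate ContinuousMap
open Filter Set Function TopologicalSpace MeasureTheory

attribute [summit_statement] _root_.GeneralizedHardyLittlewood

-- earlier MAD (stmt-Parity-8049, replaced 2026-08-15T12:33:20Z -> stmt-Parity-8208): retired by None — CosetDecorrelation ∧ FanDecorrelation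
/-- item stmt-Parity-8208 · target · rank 0 · closed · moot by None · by planner
why it might fail: both halves are square-root laws for deterministic λ with only (log M)^{1/2} of room in the random model; each is false in the Landau–Siegel caricature λ ≈ χ₁ (mod q), q ≤ M^{1/4−ϑ}, q ∣ j.
sources: Pitt2012, DukeFriedlanderIwaniec1994, Polymath8b2014, Harman2007
[target] X = CosetDecorrelation ∧ FanDecorrelation, written out self-contained (the conjunction of
the two crux statements verbatim; definitionally MAD ↔ CosetDecorrelation ∧ FanDecorrelation). Card
minor-arc-decorrelation item 3 in the (m,m′) frame, card θ = 2ϑ. -/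
@[route_item "route-Parity-MinorArcDecorrelation"]
def MAD : Prop :=
  (∀ c : ℤ, c ≠ 0 → ∃ ϑ : ℝ, ϑ < 1 / 4 ∧ ∃ C : ℝ, ∀ M n n' j : ℕ, 1 ≤ n → 1 ≤ n' → n ≠ n' → n ≤ 2 * M → n' ≤ 2 * M → Nat.sqrt M + 1 ≤ j → j < 2 * (Nat.sqrt M + 1) → |∑ p ∈ (Finset.Ioc M (2 * M) ×ˢ Finset.Ioc M (2 * M)).filter (fun p : ℕ × ℕ => p.1 ≡ p.2 [MOD j]), (ArithmeticFunction.liouville (Int.toNat ((p.1 : ℤ) * n + c)) : ℝ) * (ArithmeticFunction.liouville (Int.toNat ((p.2 : ℤ) * n' + c)) : ℝ)| ≤ C * (M : ℝ) ^ (3 / 4 + ϑ)) ∧ (∀ c : ℤ, c ≠ 0 → ∃ ϑ : ℝ, ϑ < 1 / 4 ∧ ∃ C : ℝ, ∀ M n n' : ℕ, ∀ k : ℤ, 1 ≤ n → 1 ≤ n' → n ≠ n' → n ≤ 2 * M → n' ≤ 2 * M → k ≠ 0 → |∑ j ∈ Finset.Ico (Nat.sqrt M + 1) (2 * (Nat.sqrt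 M + 1)), ∑ p ∈ (Finset.Ioc M (2 * M) ×ˢ Finset.Ioc M (2 * M)).filter (fun p : ℕ × ℕ => (p.1 : ℤ) - p.2 = k * (j : ℤ)), (ArithmeticFunction.liouville (Int.toNat ((p.1 : ℤ) * n + c)) : ℝ) * (ArithmeticFunction.liouville (Int.toNat ((p.2 : ℤ) * n' + c)) : ℝ)| ≤ C * (M : ℝ) ^ (3 / 4 + ϑ))

/-- item stmt-Parity-8050 · crux · rank 2 · closed · moot by None · by planner
why it might fail: Random model leaves only √(log M) below M^{3/4}, so ϑ>0 is load-bearing; a Landau–Siegel character χ₁ mod q∣j, q ≤ M^{1/4−ϑ}, in its mimicry range forces T_j ≈ M^{3/2}/(jq); no deterministic multiplicative function is known to satisfy any bilinear decorrelation of this strength (beyond GRH).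
sources: Pitt2012, DukeFriedlanderIwaniec1994, Polymath8b2014, TaoTeravainen2021, Montgomery1971, Literature.Barriers.Parity.UnboundedSiegelZeros
[crux] MAD proper (card item 3, efficient frame). For every shift c ≠ 0 there are ϑ < 1/4 and C such
that for all M, all dilations 1 ≤ n ≠ n′ ≤ 2M and all moduli j ∈ [Q, 2Q), Q = ⌊√M⌋+1:
|∑_{m,m′∈(M,2M], m≡m′ (mod j)} λ(mn+c)λ(m′n′+c)| ≤ C·M^{3/4+ϑ}. Equivalently ∑_{a mod j} G_n(a/j)
conj G_{n′}(a/j) ≪ j·M^{3/4+ϑ} with G_n(α) = ∑_{m∼M} λ(mn+c)e(αm): the Liouville exponential sums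
along the progressions c mod n and c mod n′ decorrelate across the Farey points of one denominator j
≍ √M (random size M^{3/4}, trivial M^{3/2}; c = 0 or n = n′ would make T_j a variance ≈ +M^{3/2}/j,
hence the exclusions). [difficulty: open-problem] -/
@[route_item "route-Parity-MinorArcDecorrelation"]
def CosetDecorrelation : Prop :=
  ∀ c : ℤ, c ≠ 0 → ∃ ϑ : ℝ, ϑ < 1 / 4 ∧ ∃ C : ℝ, ∀ M n n' j : ℕ, 1 ≤ n → 1 ≤ n' → n ≠ n' → n ≤ 2 * M → n' ≤ 2 * M → Nat.sqrt M + 1 ≤ j → j < 2 * (Nat.sqrt M + 1) → |∑ p ∈ (Finset.Ioc M (2 * M) ×ˢ Finset.Ioc M (2 * M)).filter (fun p : ℕ × ℕ => p.1 ≡ p.2 [MOD j]), (ArithmeticFunction.liouville (Int.toNat ((p.1 : ℤ) * n + c)) : ℝ) * (ArithmeticFunction.liouville (Int.toNat ((p.2 : ℤ) * n' + c)) : ℝ)| ≤ C * (M : ℝ) ^ (3 / 4 + ϑ)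

/-- item stmt-Parity-8051 · crux · rank 3 · closed · moot by None · by planner
why it might fail: Decoupling λ(mn+c) from the short progression sums by Cauchy–Schwarz caps any proof at M^{5/4} (even under GRH), so genuinely bilinear cancellation is needed; Matomäki–Radziwiłł–Tao averaging gives o(M^{3/2}), never M^{3/4+ϑ}; same Siegel caricature as for cosets.
sources: MatomakiRadziwillTao2015, MatomakiRadziwillAnnals2016, DukeFriedlanderIwaniec1994, TaoFMP2016
[crux] The complementary-divisor half of the δ-method (card item 1's 'trivial ranges / u-integral',
made explicit). Same quantifiers; for every k ≠ 0: |∑_{j∈[Q,2Q)} ∑_{m,m′∈(M,2M], m−m′=kj}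
λ(mn+c)λ(m′n′+c)| ≤ C·M^{3/4+ϑ}. Dually R_k = ∑_{j∈J} A(kj) is an average, over ≍ √M second-shifts
in arithmetic progression (difference k·n′), of the dilated two-point sums A(d) = ∑_m
λ(mn+c)λ(mn′+c−dn′); for k = 1 it is ∑_m λ(mn+c) × (λ summed over √M consecutive terms of the
progression c mod n′). Square-root cancellation in the signed average is asked (random size M^{3/4};
empty for |k| > M/Q). [difficulty: open-problem] -/
@[route_item "route-Parity-MinorArcDecorrelation"]
def FanDecorrelation : Prop :=
  ∀ c : ℤ, c ≠ 0 → ∃ ϑ : ℝ, ϑ < 1 / 4 ∧ ∃ C : ℝ, ∀ M n n' : ℕ, ∀ k : ℤ, 1 ≤ n → 1 ≤ n' → n ≠ n' → n ≤ 2 * M → n' ≤ 2 * M → k ≠ 0 → |∑ j ∈ Finset.Ico (Nat.sqrt M + 1) (2 * (Nat.sqrt M + 1)), ∑ p ∈ (Finset.Ioc M (2 * M) ×ˢ Finset.Ioc M (2 * M)).filter (fun p : ℕ × ℕ => (p.1 : ℤ) - p.2 = k * (j : ℤ)), (ArithmeticFunction.liouville (Int.toNat ((p.1 : ℤ) * n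 + c)) : ℝ) * (ArithmeticFunction.liouville (Int.toNat ((p.2 : ℤ) * n' + c)) : ℝ)| ≤ C * (M : ℝ) ^ (3 / 4 + ϑ)

/-- item stmt-Parity-8052 · crux · rank 4 · closed · moot by None · by planner
why it might fail: Power savings in λ-correlations are GRH-deep: heuristically a zero β > 1−κ/2 of ζ or of L(s,χ), χ mod nn′, leaves a term M^{2β−1} (cf. Bhowmik–Ruzsa for Goldbach averages); only the log-averaged o() is known (Tao FMP 2016 Thm 1.2); uniformity n,n′ ≤ 2M is level 1/2.
sources: TaoFMP2016, BhowmikRuzsa2018, HelfgottRadziwill2021, Literature.Barriers.Parity.GoldbachAverageZeros, Literature.Barriers.Parity.Polymath2014_liouvillePairAP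
[crux] The node the route's engine delivers and the sieve consumes: power-saving two-point Chowla
for DILATED pairs, uniform in the dilations. For every c ≠ 0 there are κ > 0 and C with
|∑_{m∈(M,2M]} λ(mn+c)λ(mn′+c)| ≤ C·M^{1−κ} for all M and all 1 ≤ n ≠ n′ ≤ 2M. (Implied by cruxes 2 ∧
3 with κ = 1/4 − ϑ via DivisorSwitch; filed as a crux so that other engines and refuters can engage
the OUTPUT directly; n = 1 is ∑_k λ(k)λ(n′k + c(1−n′)).) [deps: CosetDecorrelation,
FanDecorrelation] [difficulty: open-problem] -/
@[route_item "route-Parity-MinorArcDecorrelation"]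
def DilatedChowla : Prop :=
  ∀ c : ℤ, c ≠ 0 → ∃ κ : ℝ, 0 < κ ∧ ∃ C : ℝ, ∀ M n n' : ℕ, 1 ≤ n → 1 ≤ n' → n ≠ n' → n ≤ 2 * M → n' ≤ 2 * M → |∑ m ∈ Finset.Ioc M (2 * M), (ArithmeticFunction.liouville (Int.toNat ((m : ℤ) * n + c)) : ℝ) * (ArithmeticFunction.liouville (Int.toNat ((m : ℤ) * n' + c)) : ℝ)| ≤ C * (M : ℝ) ^ (1 - κ)

/-- item stmt-Parity-0612 · support · rank 9 · closed · moot by None · by planner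
sources: Literature.NumberTheory.Sieve.MoebiusShiftedPrimesConjecture, Lichtman2020, Harman2007
Atom (M_m,h): for all m ≥ 1, h ≥ 1: ∑_{d ≤ x} μ(d) Λ(dm + h) = o(x), i.e. the Möbius function of
(p-h)/m does not correlate with primality of p along p ≡ h (mod m). Open (parity-breaking); m = 1 is
'μ(p - h) has mean 0 over primes'. -/
@[route_item "route-Parity-MinorArcDecorrelation"]
def MobiusDilatedShiftedPrimes : Prop :=
  ∀ m h : ℕ, 1 ≤ m → 1 ≤ h → (fun x : ℕ => ∑ d ∈ Finset.Icc 1 x, (ArithmeticFunction.moebius d : ℝ) * ArithmeticFunction.vonMangoldt (d * m + h)) =o[Filter.atTop] fun x : ℕ => (x : ℝ)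

/-- item stmt-Parity-4223 · support · rank 9 · closed · moot by None · by planner
sources: Lichtman2020, Ramare2018ChowlaLiouvilleMoebius, Literature.NumberTheory.Sieve.MoebiusShiftedPrimesConjecture
[support] From Liouville to Möbius along dilated shifted primes: the conclusion of SieveReduction
(all m, w, c) implies stmt-Parity-0612 (∑_{d≤x} μ(d)Λ(dm+h) = o(x) ∀ m,h ≥ 1) and
Literature.NumberTheory.Sieve.MoebiusShiftedPrimesConjecture (∑_{p≤X} μ(p+h) = o(π(X))). Proof plan:
μ(n) = λ(n)∑_{k²∣n} μ(k) (in tree: moebius_eq_sum_sq_dvd), λ((p−h)/m) = λ(m)λ(p−h) when m ∣ p−h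
(complete multiplicativity), so ∑_d μ(d)Λ(dm+h) = λ(m) ∑_{k ≤ K} μ(k) ∑_{p ≤ xm+h, p ≡ h (mk²)} Λ(p)
λ(p−h) + O(x·(m/φ(m))/K) by Brun–Titchmarsh (or the trivial bound) for the tail; each k-term is o(x)
by the hypothesis with (mk², h mod mk², c = −h); let K → ∞; π-normalisation by partial summation,
prime powers O(√x). [difficulty: M] -/
@[route_item "route-Parity-MinorArcDecorrelation"]
def LiouvilleToMobius : Prop :=
  (∀ m : ℕ, 1 ≤ m → ∀ w : ℕ, ∀ c : ℤ, c ≠ 0 → ∀ A : ℝ, 0 < A → ∃ C x₀ : ℝ, ∀ x : ℝ, x₀ ≤ x → |∑ n ∈ (Finset.Icc 1 ⌊x⌋₊).filter (fun n : ℕ => n ≡ w [MOD m]), ArithmeticFunction.vonMangoldt n * (ArithmeticFunction.liouville (Int.toNat ((n : ℤ) + c)) : ℝ)| ≤ C * x / Real.log x ^ A) → (∀ m h : ℕ, 1 ≤ m → 1 ≤ h → (fun x : ℕ => ∑ d ∈ Finset.Icc 1 x, (ArithmeticFunction.moebius d : ℝ) * ArithmeticFunction.vonMangoldt (d * m + h))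 =o[Filter.atTop] fun x : ℕ => (x : ℝ)) ∧ Literature.NumberTheory.Sieve.MoebiusShiftedPrimesConjecture

/-- item stmt-Parity-8053 · support · rank 9 · closed · moot by None · by planner
sources: DukeFriedlanderIwaniec1994, HeathBrown1996Crelle481, IwaniecKowalski2004
[support] The δ-method as an exact elementary identity (DFI divisor switching with sharp weights, no
Fourier analysis): for every f : ℕ → ℕ → ℝ and all M, Q, |J|·∑_{m∈(M,2M]} f(m,m) + ∑_{0<|k|≤M}
∑_{j∈J} ∑_{m−m′=kj} f(m,m′) = ∑_{j∈J} ∑_{m≡m′ (mod j)} f(m,m′), J = [Q,2Q), pairs in (M,2M]². Proof: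
for each j split the coset by k = (m−m′)/j; k = 0 is the diagonal. (Checked numerically by the
planner for M ≤ 20, all Q.) [difficulty: provable-now] -/
@[route_item "route-Parity-MinorArcDecorrelation"]
def DivisorSwitch : Prop :=
  ∀ (f : ℕ → ℕ → ℝ) (M Q : ℕ), ((Finset.Ico Q (2 * Q)).card : ℝ) * (∑ m ∈ Finset.Ioc M (2 * M), f m m) + (∑ k ∈ (Finset.Icc (-(M : ℤ)) M).erase 0, ∑ j ∈ Finset.Ico Q (2 * Q), ∑ p ∈ (Finset.Ioc M (2 * M) ×ˢ Finset.Ioc M (2 * M)).filter (fun p : ℕ × ℕ => (p.1 : ℤ) - p.2 = k * (j : ℤ)), f p.1 p.2) = ∑ j ∈ Finset.Ico Q (2 * Q), ∑ p ∈ (Finset.Ioc M (2 * M) ×ˢ Finset.Ioc M (2 * M)).filter (fun p : ℕ × ℕ => p.1 ≡ p.2 [MOD j]), f p.1 p.2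

/-- item stmt-Parity-8054 · support · rank 9 · closed · moot by None · by planner
sources: DukeFriedlanderIwaniec1994, Pitt2012
[support] CosetDecorrelation → FanDecorrelation → DilatedChowla. Proof: DivisorSwitch with f(m,m′) =
λ(mn+c)λ(m′n′+c), Q = ⌊√M⌋+1 (so |J| = Q, Q² > M); the fan sums are EMPTY for |k| > M/Q, so |S| ≤
(1/Q)(Q·C₁M^{3/4+ϑ₁} + 2(M/Q)·C₂M^{3/4+ϑ₂}) ≤ (C₁+2C₂)M^{1−κ}, κ = 1/4 − max(ϑ₁,ϑ₂) > 0.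
[difficulty: provable-now] -/
@[route_item "route-Parity-MinorArcDecorrelation"]
def DecorrelationToDilatedChowla : Prop :=
  CosetDecorrelation → FanDecorrelation → DilatedChowla

/-- item stmt-Parity-8055 · support · rank 9 · closed · moot by None · by planner
sources: Polymath8b2014, Harman2007, BourgainSarnakZiegler2013, FordMaynard2024PrimeSieves
[support] Power-saving Type II for λ(mn+c) on the balanced range (short variable n ≤ long variable
m, dyadic boxes, arbitrary real coefficients): for c ≠ 0 there are η > 0, C with
|∑_{m∈(M,2M]}∑_{n∈(N,2N]} α_m β_n λ(mn+c)| ≤ C‖α‖₂‖β‖₂ (MN)^{1/2}(N^{−1/2} + M^{−η}) whenever 1 ≤ N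
≤ M. The bilinear, main-term-free, parity-sensitive input Polymath 8b §8 and Harman §14.2 ask for;
sub-boxes by zero-extension of the coefficients. [difficulty: open-problem] -/
@[route_item "route-Parity-MinorArcDecorrelation"]
def TypeIILiouville : Prop :=
  ∀ c : ℤ, c ≠ 0 → ∃ η : ℝ, 0 < η ∧ ∃ C : ℝ, ∀ M N : ℕ, 1 ≤ N → N ≤ M → ∀ α β : ℕ → ℝ, |∑ m ∈ Finset.Ioc M (2 * M), ∑ n ∈ Finset.Ioc N (2 * N), α m * β n * (ArithmeticFunction.liouville (Int.toNat ((m : ℤ) * n + c)) : ℝ)| ≤ C * Real.sqrt (∑ m ∈ Finset.Ioc M (2 * M), α m ^ 2) * Real.sqrt (∑ n ∈ Finset.Ioc N (2 * N), β n ^ 2) * Real.sqrt ((M : ℝ) * N) * ((N : ℝ) ^ (-(1 / 2 : ℝ)) + (M : ℝ) ^ (-η))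

/-- item stmt-Parity-8056 · support · rank 9 · closed · moot by None · by planner
sources: Harman2007, IwaniecKowalski2004
[support] DilatedChowla → TypeIILiouville by Cauchy–Schwarz over the long variable: |B|² ≤ ‖α‖²
∑_{n,n′} β_nβ_{n′} ∑_m λ(mn+c)λ(mn′+c) ≤ ‖α‖²‖β‖²(M + N·C M^{1−κ}) (diagonal n = n′ has M terms;
(∑|β_n|)² ≤ N‖β‖²; n′ ≤ 2N ≤ 2M is inside DilatedChowla's range), so η = κ/2. [difficulty:
provable-now] -/
@[route_item "route-Parity-MinorArcDecorrelation"]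
def DilatedChowlaToTypeII : Prop :=
  DilatedChowla → TypeIILiouville

/-- item stmt-Parity-8057 · support · rank 9 · closed · moot by None · by planner
sources: BombieriFriedlanderIwaniecActa1986, IwaniecKowalski2004, Vaughan1980, Heathbrown1982
[support] Bombieri–Vinogradov for λ at level x^{1/2−ε} with absolute values, one arbitrary residue
c_d ∈ [0,d) and height y_d ≤ x per modulus d ≥ 1: ∑_{d≤x^{1/2−ε}} |∑_{n≤y_d/d} λ(dn+c_d)| ≤ Cx/(log
x)^A. Known theorem (Heath-Brown identity for λ = μ∗1_□ + BFI Theorem 0(b) + Siegel–Walfisz for λ,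
all in tree). NB: this is stmt-Parity-4220 of route ShiftedMultiplicationTable with the residue
condition restricted to d ≥ 1 — as filed there (∀ d, 0 ≤ c d ∧ c d < d) the d = 0 instance is
unsatisfiable and 4220 is vacuously true (planner's kernel-checked note, folder VacuityTest.lean),
hence unusable as a hypothesis. [difficulty: L] -/
@[route_item "route-Parity-MinorArcDecorrelation"]
def BombieriVinogradovLiouville : Prop :=
  ∀ ε : ℝ, 0 < ε → ∀ A : ℝ, 0 < A → ∃ C x₀ : ℝ, ∀ x : ℝ, x₀ ≤ x → ∀ c : ℕ → ℤ, ∀ y : ℕ → ℝ, (∀ d, 1 ≤ d → 0 ≤ c d ∧ c d < d) → (∀ d, 0 ≤ y d ∧ y d ≤ x) → (∑ d ∈ Finset.Icc 1 ⌊x ^ (1 / 2 - ε)⌋₊, |∑ n ∈ Finset.Icc 1 ⌊y d / d⌋₊, (ArithmeticFunction.liouville (Int.toNat ((d : ℤ) * n + c d)) : ℝ)|) ≤ C * x / Real.log x ^ A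

/-- item stmt-Parity-8058 · support · rank 9 · closed · moot by None · by planner
sources: Vaughan1980, Heathbrown1982, Harman2007, IwaniecKowalski2004
[support] TypeIILiouville → BombieriVinogradovLiouville → for every modulus m ≥ 1, class w, shift c
≠ 0 and A: |∑_{n≤x, n≡w (m)} Λ(n)λ(n+c)| ≤ Cx/(log x)^A (verbatim the antecedent of
LiouvilleToMobius). Plan: Heath-Brown's identity (in tree, K = 2) or Vaughan's with U = V =
x^{1/10}; any factorisation with a partial product in [x^{1/10}, x^{9/10}] is Type II (short side ≤
x^{1/2} ≤ long side; divisor-bounded coefficients cost log powers against the power saving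
N^{−1/2}+M^{−η}; the class n ≡ w (m) by splitting coefficients into classes; the cut mn ≤ x by
x^{−η/3}-fine subdivision); otherwise one smooth variable ≥ x^{9/10} ⇒ Type I with modulus ≤
x^{1/10} ⇒ BombieriVinogradovLiouville (log weight by partial summation using the free heights y_d;
τ-bounded outer coefficients by Cauchy–Schwarz against the trivial bound). Output only log-power
because Type I is. [difficulty: L] -/
@[route_item "route-Parity-MinorArcDecorrelation"]
def VaughanReduction : Prop :=
  TypeIILiouville → BombieriVinogradovLiouville → (∀ m : ℕ, 1 ≤ m → ∀ w : ℕ, ∀ c : ℤ, c ≠ 0 → ∀ A : ℝ, 0 < A → ∃ C x₀ : ℝ, ∀ x : ℝ, x₀ ≤ x → |∑ n ∈ (Finset.Icc 1 ⌊x⌋₊).filter (fun n : ℕ => n ≡ w [MOD m]), ArithmeticFunction.vonMangoldt n * (ArithmeticFunction.liouville (Int.toNat ((n : ℤ) + c)) : ℝ)| ≤ C * x / Real.log x ^ A)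

/-- item stmt-Parity-8059 · assembly · rank 1 · closed · moot by None · by planner
sources: Pitt2012, Harman2007, Heathbrown1982, Lichtman2020
[assembly] CosetDecorrelation → FanDecorrelation → BombieriVinogradovLiouville →
MobiusDilatedShiftedPrimes (= stmt-Parity-0612), by composing DecorrelationToDilatedChowla,
DilatedChowlaToTypeII, VaughanReduction and LiouvilleToMobius. -/
@[route_item "route-Parity-MinorArcDecorrelation"]
def Assembly : Prop :=
  CosetDecorrelation → FanDecorrelation → BombieriVinogradovLiouville → MobiusDilatedShiftedPrimes

end Summit.Parity.GeneralizedHardyLittlewood.Theses.MinorArcDecorrelation
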